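import Literature.AlgebraicGeometry.Motives.HodgeLieWeightOnePlusLineKilling
import Literature.AlgebraicGeometry.Motives.HodgeLieWeightOnePlusLineSimple
import Literature.AlgebraicGeometry.Motives.MumfordTateInvariantsOrthonormalBasis
import Literature.AlgebraicGeometry.Motives.MumfordTateRankTwo
import HarnessLib

/-!
# Weight one, plus-PAIR data `(B₀, C₀, μ₀)` ⟹ the plus-LINE hypotheses of `HodgeLieWeightOnePlusLine*` in every graded basis,
# and the Killing identity `8 · tr_{V_ℂ}(xy) = dim V · κ(x, y)` on `𝔥_ℂ`

Family `hodge`, layer `Literature/AlgebraicGeometry/Motives`; THEOREMS ONLY (no definition, no named fact; D-0026).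
Written for the cell `pub-hodge-ring2` (literature lane gen 67, programme R44 «shape (S1) = `Hg = Sp₁₀` for simple abelian
fivefolds with `End⁰ = ℚ`», file F3b).  Honest framing of that cell: research route conditional on HC_CM; not a corollary;
Q11.4-sentence-2 already refuted in dim ≥ 3.  (This file is unconditional.)

THE BRIDGE.  `SymplecticThetaTen.dichotomy` (file `HodgeThetaSubalgebraSymplecticRankTen`) phrases the plus-line position by
OPERATORS ON THE HODGE PIECES: a raising `B₀ ∈ 𝔥_ℂ` (`B₀ V^{1,0} = 0`, `B₀ V_ℂ ⊆ V^{1,0}`) with `𝔥_ℂ⁺ = ℂB₀`, its conjugate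
`C₀` with `𝔥_ℂ⁻ = ℂC₀`, `B₀C₀ = μ₀` on `V^{1,0}`.  The tree's type-III files `HodgeLieWeightOnePlusLine{,Ideal,Killing,Sl2Triple,
Casimir,…}` (cell `pub-hodgecm2`, seat b27) phrase it in a GRADED BASIS `e` through the projector `P = gradingEnd e deg` and a
rational `X ∈ 𝔥 ∖ End_Hdg`: `(h⁺)` every `P Y (1 − P)`, `Y ∈ 𝔥_ℂ`, is a multiple of `E = P X_ℂ (1 − P)`; `(h⁻)` likewise for
`F = (1 − P) X_ℂ P`.  Here:
* §1 **`plusLine_gradingEnd_of_plusPair`**, **`minusLine_gradingEnd_of_plusPair`** — the operator data give `(h⁺)`, `(h⁻)` in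
  ANY graded basis with degrees in `{0,1}`, for ANY rational `X ∈ 𝔥 ∖ End_Hdg`, together with `E = c B₀`, `F = c' C₀`, `c, c' ≠ 0`
  (`P` is the identity on `V^{1,0} = span{e_σ : deg σ = 1}` and zero on `V^{0,1}`, so `P Y (1 − P)` is raising; `E ≠ 0` by
  `projE_ne_zero_of_not_mem_endAlg`).
* §2 **`exists_mem_hodgeLie_not_mem_endAlg`** — `𝔷 = 0` and `𝔥_ℂ ∋ B₀ ≠ 0` give a rational `X ∈ 𝔥 ∖ End_Hdg`.
* §3 **`eight_mul_trace_mul_eq_finrank_mul_killingForm_of_plusPair`** — consequently (with `𝔥` `ℚ`-simple by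
  `isSimple_hodgeLie_of_plusLine`) the Galois-swap identity of `HodgeLieWeightOnePlusLineKilling` holds in the operator language:
  `8 · tr_{V_ℂ}(x y) = dim_ℚ V · κ_{𝔏'}(x, y)` for all `x, y` in any Lie subalgebra `𝔏'` with carrier `𝔥_ℂ`.

## References

* [MoonenZarhin1999LowDim] B. Moonen, Yu. Zarhin, *Hodge classes on abelian varieties of low dimension*, Math. Ann. 315
  (1999), §2 (2.3) (type III / Mumford position).
* [Deligne1982HodgeCycles] P. Deligne, *Hodge cycles on abelian varieties*, LNM 900 (1982), I §3 (3.1, proof of 3.4, 3.6).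
* [Jacobson1962LieAlgebras] N. Jacobson, *Lie Algebras* (1962), Ch. X §1, Ch. III §4.
-/

noncomputable section

open scoped TensorProduct

namespace Literature.AlgebraicGeometry.Motives

universe u

namespace HodgeStructure

open ProjectorBlocks Literature.RepresentationTheory.GeneralLinear

variable {V : Type u} [AddCommGroup V] [Module ℚ V] [Module.Finite ℚ V] [HodgeTensorFacts.{u, u}] {n : ℤ}
  {S : Type u} [Fintype S] [DecidableEq S] {deg : S → ℤ}

/-! ## §0 The projector of a graded basis on the Hodge pieces (weight one) -/

omit [Module.Finite ℚ V] [HodgeTensorFacts.{u, u}] in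
/-- In weight `1` with degrees in `{0,1}`: `P = gradingEnd e deg` is the identity on `V^{1,0}`, zero on `V^{0,1}`, `P v ∈ V^{1,0}`
and `(1 − P) v ∈ V^{0,1}` (`V^{1,0} = span{e_σ : deg σ = 1}`, `V^{0,1} = span{e_σ : deg σ = 0}`).
[cite: Deligne1982HodgeCycles, I §3 (3.1 and proof of Prop. 3.4)] -/
theorem gradingEnd_pieces_weightOne (H : HodgeStructure V n) (hn : n = 1) (e : Module.Basis S ℂ (ℂ ⊗[ℚ] V))
    (hF : ∀ a, H.F a = Submodule.span ℂ (e '' {σ | a ≤ deg σ}))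
    (hFc : ∀ a, complexConj (H.F a) = Submodule.span ℂ (e '' {σ | deg σ ≤ n - a}))
    (hdeg : ∀ σ, deg σ = 0 ∨ deg σ = 1) :
    (∀ p ∈ H.piece 1 0, gradingEnd e deg p = p) ∧ (∀ q ∈ H.piece 0 1, gradingEnd e deg q = 0) ∧
      (∀ v, gradingEnd e deg v ∈ H.piece 1 0) ∧ (∀ v, (1 - gradingEnd e deg) v ∈ H.piece 0 1) := by
  subst hn
  have hPdiag : ∀ σ, gradingEnd e deg (e σ) = (fun d : ℤ => (d : ℂ)) (deg σ) • e σ := gradingEnd_apply_basis e deg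
  have h10 : H.piece 1 0 = Submodule.span ℂ (e '' {σ | deg σ = 1}) := by
    have h := piece_eq_span_of_graded H e hF hFc 1
    rwa [sub_self] at h
  have h01 : H.piece 0 1 = Submodule.span ℂ (e '' {σ | deg σ = 0}) := by
    have h := piece_eq_span_of_graded H e hF hFc 0
    rwa [sub_zero] at h
  refine ⟨fun p hp => ?_, fun q hq => ?_, fun v => ?_, fun v => ?_⟩
  · have h := apply_eq_smul_of_mem_piece_of_graded H e hF hFc _ hPdiag 1 (x := p) (by rwa [sub_self])
    rwa [Int.cast_one, one_smul] at h
  · have h := apply_eq_smul_of_mem_piece_of_graded H e hF hFc _ hPdiag 0 (x := q) (by rwa [sub_zero])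
    rwa [Int.cast_zero, zero_smul] at h
  · rw [h10]; exact gradingEnd_apply_mem_span_one e hdeg v
  · rw [h01]; exact one_sub_gradingEnd_apply_mem_span_zero e hdeg v

/-! ## §1 Plus-pair data ⟹ `(h⁺)`, `(h⁻)` in a graded basis -/

/-- **`(h⁺)` from the raising line.**  If the raising operators of `𝔥_ℂ` form the line `ℂB₀`, then in any graded basis with
degrees in `{0,1}` and for any rational `X ∈ 𝔥 ∖ End_Hdg`: `E = P X_ℂ (1 − P) = c_X B₀` with `c_X ≠ 0`, and every
`P Y (1 − P)`, `Y ∈ 𝔥_ℂ`, is a multiple of `E`. [cite: MoonenZarhin1999LowDim, §2 (2.3)]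
[cite: Deligne1982HodgeCycles, I §3 (proof of Prop. 3.4)] -/
theorem plusLine_gradingEnd_of_plusPair (H : HodgeStructure V n) (hn : n = 1)
    (e : Module.Basis S ℂ (ℂ ⊗[ℚ] V)) (hF : ∀ a, H.F a = Submodule.span ℂ (e '' {σ | a ≤ deg σ}))
    (hFc : ∀ a, complexConj (H.F a) = Submodule.span ℂ (e '' {σ | deg σ ≤ n - a}))
    (hdeg : ∀ σ, deg σ = 0 ∨ deg σ = 1) {X : Module.End ℚ V} (hX : X ∈ H.hodgeLie) (hXE : X ∉ H.endAlg)
    {B₀ : Module.End ℂ (ℂ ⊗[ℚ] V)}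
    (hline : ∀ B ∈ H.hodgeLieC, (∀ p ∈ H.piece 1 0, B p = 0) → (∀ v, B v ∈ H.piece 1 0) → ∃ c : ℂ, B = c • B₀) :
    (∃ cX : ℂ, cX ≠ 0 ∧ gradingEnd e deg * X.baseChange ℂ * (1 - gradingEnd e deg) = cX • B₀) ∧
      ∀ Y ∈ H.hodgeLieC, ∃ c : ℂ,
        gradingEnd e deg * Y * (1 - gradingEnd e deg) = c • (gradingEnd e deg * X.baseChange ℂ * (1 - gradingEnd e deg)) := by
  obtain ⟨hP1, -, hPim, -⟩ := gradingEnd_pieces_weightOne H hn e hF hFc hdeg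
  set P := gradingEnd e deg with hP
  have hraise : ∀ Y ∈ H.hodgeLieC, ∃ c : ℂ, P * Y * (1 - P) = c • B₀ := fun Y hY =>
    hline _ (projE_mem_hodgeLieC H e hF hFc hdeg hY).1
      (fun p hp => by rw [Module.End.mul_apply, Module.End.mul_apply, LinearMap.sub_apply, Module.End.one_apply, hP1 p hp,
        sub_self, map_zero, map_zero])
      (fun v => by rw [Module.End.mul_apply]; exact hPim _)
  obtain ⟨cX, hcX⟩ := hraise _ (H.baseChange_mem_hodgeLieC hX)
  have hcX0 : cX ≠ 0 := by
    rintro rfl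
    rw [zero_smul] at hcX
    exact (projE_ne_zero_of_not_mem_endAlg H hn e hF hFc hdeg hXE).1 hcX
  refine ⟨⟨cX, hcX0, hcX⟩, fun Y hY => ?_⟩
  obtain ⟨c, hc⟩ := hraise Y hY
  refine ⟨c * cX⁻¹, ?_⟩
  rw [hc, hcX, smul_smul, mul_assoc, inv_mul_cancel₀ hcX0, mul_one]

/-- **`(h⁻)` from the lowering line** (the conjugate statement): `F = (1 − P) X_ℂ P = c'_X C₀` with `c'_X ≠ 0`, and every
`(1 − P) Y P`, `Y ∈ 𝔥_ℂ`, is a multiple of `F`. [cite: MoonenZarhin1999LowDim, §2 (2.3)]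
[cite: Deligne1982HodgeCycles, I §3 (proof of Prop. 3.4)] -/
theorem minusLine_gradingEnd_of_plusPair (H : HodgeStructure V n) (hn : n = 1)
    (e : Module.Basis S ℂ (ℂ ⊗[ℚ] V)) (hF : ∀ a, H.F a = Submodule.span ℂ (e '' {σ | a ≤ deg σ}))
    (hFc : ∀ a, complexConj (H.F a) = Submodule.span ℂ (e '' {σ | deg σ ≤ n - a}))
    (hdeg : ∀ σ, deg σ = 0 ∨ deg σ = 1) {X : Module.End ℚ V} (hX : X ∈ H.hodgeLie) (hXE : X ∉ H.endAlg)
    {C₀ : Module.End ℂ (ℂ ⊗[ℚ] V)}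
    (hline' : ∀ C ∈ H.hodgeLieC, (∀ q ∈ H.piece 0 1, C q = 0) → (∀ v, C v ∈ H.piece 0 1) → ∃ c : ℂ, C = c • C₀) :
    (∃ cX : ℂ, cX ≠ 0 ∧ (1 - gradingEnd e deg) * X.baseChange ℂ * gradingEnd e deg = cX • C₀) ∧
      ∀ Y ∈ H.hodgeLieC, ∃ c : ℂ,
        (1 - gradingEnd e deg) * Y * gradingEnd e deg = c • ((1 - gradingEnd e deg) * X.baseChange ℂ * gradingEnd e deg) := by
  obtain ⟨-, hP0, -, hQim⟩ := gradingEnd_pieces_weightOne H hn e hF hFc hdeg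
  set P := gradingEnd e deg with hP
  have hlower : ∀ Y ∈ H.hodgeLieC, ∃ c : ℂ, (1 - P) * Y * P = c • C₀ := fun Y hY =>
    hline' _ (projE_mem_hodgeLieC H e hF hFc hdeg hY).2
      (fun q hq => by rw [Module.End.mul_apply, Module.End.mul_apply, hP0 q hq, map_zero, map_zero])
      (fun v => by rw [Module.End.mul_apply]; exact hQim _)
  obtain ⟨cX, hcX⟩ := hlower _ (H.baseChange_mem_hodgeLieC hX)
  have hcX0 : cX ≠ 0 := by
    rintro rfl
    rw [zero_smul] at hcX
    exact (projE_ne_zero_of_not_mem_endAlg H hn e hF hFc hdeg hXE).2 hcX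
  refine ⟨⟨cX, hcX0, hcX⟩, fun Y hY => ?_⟩
  obtain ⟨c, hc⟩ := hlower Y hY
  refine ⟨c * cX⁻¹, ?_⟩
  rw [hc, hcX, smul_smul, mul_assoc, inv_mul_cancel₀ hcX0, mul_one]

/-! ## §2 A rational element of `𝔥` outside `End_Hdg` -/

/-- **`𝔷 = 0` and `𝔥_ℂ ∋ B₀ ≠ 0` ⟹ some rational `X ∈ 𝔥` lies outside `End_Hdg(V)`** (indeed every non-zero one does).
[cite: Deligne1982HodgeCycles, I §3 Prop. 3.6] -/
theorem exists_mem_hodgeLie_not_mem_endAlg (H : HodgeStructure V n)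
    (hz : H.hodgeLie ⊓ Subalgebra.toSubmodule H.endAlg = ⊥) {B₀ : Module.End ℂ (ℂ ⊗[ℚ] V)}
    (hB₀ : B₀ ∈ H.hodgeLieC) (hB₀0 : B₀ ≠ 0) : ∃ X ∈ H.hodgeLie, X ∉ H.endAlg := by
  by_contra hcon
  push Not at hcon
  have h0 : ∀ X ∈ H.hodgeLie, X = 0 := fun X hX => by
    have h := Submodule.mem_inf.2 ⟨hX, (Subalgebra.mem_toSubmodule _).2 (hcon X hX)⟩
    rwa [hz, Submodule.mem_bot] at h
  apply hB₀0
  have hC0 : H.hodgeLieC ≤ ⊥ := by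
    refine Submodule.span_le.2 ?_
    rintro _ ⟨X, hX, rfl⟩
    change X.baseChange ℂ ∈ (⊥ : Submodule ℂ (Module.End ℂ (ℂ ⊗[ℚ] V)))
    rw [h0 X hX, LinearMap.baseChange_zero]
    exact Submodule.zero_mem _
  exact (Submodule.mem_bot ℂ).1 (hC0 hB₀)

/-! ## §3 The Killing identity in the operator language -/

/-- **`8 · tr_{V_ℂ}(x y) = dim_ℚ V · κ_{𝔏'}(x, y)` on `𝔥_ℂ` from plus-pair data** (weight `1`, effective, `𝔷 = 0`): the
raising/lowering lines `ℂB₀`, `ℂC₀ = ℂB̄₀` with `B₀C₀ = μ₀ ≠ 0` on `V^{1,0}` give, in an orthonormal graded basis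
(`Polarization.exists_orthonormal_graded_basis`), the hypotheses `(h⁺)`, `(h⁻)` of the type-III files (§1), a rational
`X ∈ 𝔥 ∖ End_Hdg` (§2) and `ℚ`-simplicity of `𝔥` (`isSimple_hodgeLie_of_plusLine`); then
`eight_mul_trace_mul_eq_finrank_mul_killingForm_spanC` applies. [cite: MoonenZarhin1999LowDim, §2 (2.3)]
[cite: Jacobson1962LieAlgebras, Ch. X §1 and Ch. III §4] [cite: Deligne1982HodgeCycles, I §3 (3.4–3.6)] -/
theorem eight_mul_trace_mul_eq_finrank_mul_killingForm_of_plusPair (H : HodgeStructure V n) (ψ : H.Polarization)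
    (hn : n = 1) (heff : H.IsEffective) {Θ : Module.End ℂ (ℂ ⊗[ℚ] V)}
    (hΘ : ∀ p, ∀ x ∈ H.piece p (n - p), Θ x = ((2 * p - n : ℤ) : ℂ) • x)
    {B₀ C₀ : Module.End ℂ (ℂ ⊗[ℚ] V)} (hB₀ : B₀ ∈ H.hodgeLieC) (hB₀0 : B₀ ≠ 0)
    (hB₀P : ∀ p ∈ H.piece 1 0, B₀ p = 0) (hB₀im : ∀ v, B₀ v ∈ H.piece 1 0)
    (hC₀ : ∀ v, C₀ v = conj (B₀ (conj v))) {μ₀ : ℂ} (hμ₀ : μ₀ ≠ 0)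
    (hBC : ∀ p ∈ H.piece 1 0, B₀ (C₀ p) = μ₀ • p) (hCB : ∀ q ∈ H.piece 0 1, C₀ (B₀ q) = μ₀ • q)
    (hline : ∀ B ∈ H.hodgeLieC, (∀ p ∈ H.piece 1 0, B p = 0) → (∀ v, B v ∈ H.piece 1 0) → ∃ c : ℂ, B = c • B₀)
    (hline' : ∀ C ∈ H.hodgeLieC, (∀ q ∈ H.piece 0 1, C q = 0) → (∀ v, C v ∈ H.piece 0 1) → ∃ c : ℂ, C = c • C₀)
    (hz : H.hodgeLie ⊓ Subalgebra.toSubmodule H.endAlg = ⊥) :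
    letI : LieRing (Module.End ℂ (ℂ ⊗[ℚ] V)) := LieRing.ofAssociativeRing
    ∀ (𝔏' : LieSubalgebra ℂ (Module.End ℂ (ℂ ⊗[ℚ] V))), 𝔏'.toSubmodule = H.hodgeLieC → ∀ x y : 𝔏',
      8 * LinearMap.trace ℂ (ℂ ⊗[ℚ] V) ((x : Module.End ℂ (ℂ ⊗[ℚ] V)) * y) =
        (Module.finrank ℚ V : ℂ) * killingForm ℂ 𝔏' x y := by
  classical
  obtain ⟨S, _, _, deg, e, hF, hFc, -, -⟩ := ψ.exists_orthonormal_graded_basis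
  have hdeg : ∀ σ, deg σ = 0 ∨ deg σ = 1 := fun σ => by
    have h := heff.deg_mem_Icc_of_graded e hF hFc σ
    omega
  obtain ⟨X, hX, hXE⟩ := exists_mem_hodgeLie_not_mem_endAlg H hz hB₀ hB₀0
  obtain ⟨-, hplus⟩ := plusLine_gradingEnd_of_plusPair H hn e hF hFc hdeg hX hXE hline
  obtain ⟨-, hminus⟩ := minusLine_gradingEnd_of_plusPair H hn e hF hFc hdeg hX hXE hline'
  have hsimple := isSimple_hodgeLie_of_plusLine H ψ hn heff hΘ hB₀ hB₀0 hB₀P hB₀im hC₀ hμ₀ hBC hCB hline hz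
  exact eight_mul_trace_mul_eq_finrank_mul_killingForm_spanC H ψ hn e hF hFc hdeg hX hXE hplus hminus hz hsimple

end HodgeStructure

end Literature.AlgebraicGeometry.Motives
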